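import Mathlib.GroupTheory.Coprod.Basic
import Mathlib.GroupTheory.QuotientGroup.Basic
import Mathlib.Algebra.Group.Subgroup.Pointwise
import Mathlib.GroupTheory.GroupAction.ConjAct
import Mathlib.Tactic.Group
import Literature.GroupTheory.CombinatorialGroupTheory.FreeFactorFibredTwist
import HarnessLib

/-!
# Characters of a free factor of a free product extend from a level: the fibred twist for `Γ = A ∗ C`

Topic `Literature/GroupTheory/CombinatorialGroupTheory`; theorems only, Mathlib-only.  Serre, *Trees*,
I §5.5, Thm. 14 [cite: SerreTrees1980, I §5.5 Thm. 14] (its elementary `H¹` shadow); companion and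
generalisation of `FreeFactorFibredTwist.lean` (abc-iut-f-166, free factors of a FREE group): here the
ambient group is an arbitrary FREE PRODUCT `Γ = A ∗ C` (`Monoid.Coprod A C ≃* Γ`) — the factor `A` need
not be free (e.g. a closed surface group, as in `Π^unr` of a sturdy two-component pointed stable curve,
[CombGC] Def. 1.1 (ii) / Prop. 1.2 proof p. 9, where `Γ^unr = Γ_{g₀,0} ∗ Γ_{g₁,0}`).

**Theorem `exists_character_extension_of_freeProduct`.**  `N ⊴ Γ` any normal subgroup, `A' ≤ Γ` the
image of the factor `A`, `φ : A' ∩ N → M` a character (`M` abelian), `f ∈ Γ`: there is `χ : N → M`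
with `χ(f x f⁻¹) = φ(x)` on `A' ∩ N` and `χ(g x g⁻¹) = 1` whenever `f⁻¹ g ∉ A'·N`.  Construction as in
the free case: twist the `Γ`-set `Γ/N × M` over the `A'`-orbit of `π(f⁻¹)` by the cocycle induced from
`φ`, act plainly through `C`; the universal property of the coproduct (`Monoid.Coprod.lift`) glues the two
actions with no relation to check.

**Corollary `exists_normal_separating_of_freeProduct`**: for a NONTRIVIAL character `φ` with finite
cyclic image … — stated in the form needed downstream: given `x₀ ∈ A' ∩ N` with `φ x₀ ≠ 1`, there is
`U ⊴ N` (the kernel of `χ`) with `N/U ↪ M`, `f x₀ f⁻¹ ∉ U`, and `g (A' ∩ N) g⁻¹ ⊆ U` for `f⁻¹ g ∉ A' N`.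
Elementary; nothing here concerns [IUTchIII].
-/

namespace Literature.GroupTheory.CombinatorialGroupTheory

namespace FreeProductFibredTwist

open scoped Pointwise
open Monoid (Coprod)
open FreeFactorFibredTwist (apply_conj_eq normal_coe_mul_comm)

variable {A C Γ : Type*} [Group A] [Group C] [Group Γ]

/-- **Characters of a free factor of `Γ = A ∗ C` extend from a level to the whole level (fibred
twist).** [cite: SerreTrees1980, I §5.5 Thm. 14] -/
theorem exists_character_extension_of_freeProduct (e : Coprod A C ≃* Γ)
    (A' : Subgroup Γ) (hA' : A' = (e.toMonoidHom.comp (Coprod.inl : A →* Coprod A C)).range)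
    (N : Subgroup Γ) [hN : N.Normal] {M : Type*} [CommGroup M] (φ : ↥(A' ⊓ N) →* M) (f : Γ) :
    ∃ χ : N →* M,
      (∀ (x : Γ) (hx : x ∈ A' ⊓ N), χ ⟨f * x * f⁻¹, hN.conj_mem x hx.2 f⟩ = φ ⟨x, hx⟩) ∧
      ∀ g : Γ, f⁻¹ * g ∉ (A' : Set Γ) * (N : Set Γ) →
        ∀ (x : Γ) (hx : x ∈ A' ⊓ N), χ ⟨g * x * g⁻¹, hN.conj_mem x hx.2 g⟩ = 1 := by
  classical
  -- the quotient `Q = Γ/N`, the image `Ā` of the factor, the orbit `O` of `π(f⁻¹)`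
  set π : Γ →* Γ ⧸ N := QuotientGroup.mk' N with hπ
  have hπN : ∀ {x : Γ}, π x = 1 ↔ x ∈ N := fun {x} => by
    rw [hπ, QuotientGroup.mk'_apply, QuotientGroup.eq_one_iff]
  set Abar : Subgroup (Γ ⧸ N) := A'.map π with hAbar
  have hAN : ∀ {x : Γ}, π x ∈ Abar ↔ x ∈ (A' : Set Γ) * (N : Set Γ) := fun {x} => by
    have hk : A' ⊔ N = Abar.comap π := by
      rw [hAbar, Subgroup.comap_map_eq, hπ, QuotientGroup.ker_mk']
    rw [← Subgroup.mul_normal A' N, SetLike.mem_coe, hk, Subgroup.mem_comap]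
  let O : Set (Γ ⧸ N) := {q | q * π f ∈ Abar}
  have hO_iff : ∀ q, q ∈ O ↔ q * π f ∈ Abar := fun q => Iff.rfl
  have hO_mul : ∀ {a : Γ}, a ∈ A' → ∀ q, π a * q ∈ O ↔ q ∈ O := by
    intro a ha q
    rw [hO_iff, hO_iff, mul_assoc]
    exact Subgroup.mul_mem_cancel_left _ (Subgroup.mem_map_of_mem π ha)
  have hsec : ∀ q ∈ O, ∃ a ∈ A', π a = q * π f := fun q hq => Subgroup.mem_map.mp hq
  let s : Γ ⧸ N → Γ := fun q => if hq : q ∈ O then (hsec q hq).choose else 1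
  have hsA : ∀ {q}, q ∈ O → s q ∈ A' := fun {q} hq => by
    simp only [s, dif_pos hq]; exact (hsec q hq).choose_spec.1
  have hsπ : ∀ {q}, q ∈ O → π (s q) = q * π f := fun {q} hq => by
    simp only [s, dif_pos hq]; exact (hsec q hq).choose_spec.2
  have ht : ∀ {a : Γ} {q : Γ ⧸ N}, a ∈ A' → q ∈ O → (s (π a * q))⁻¹ * a * s q ∈ A' ⊓ N := by
    intro a q ha hq
    refine Subgroup.mem_inf.mpr
      ⟨A'.mul_mem (A'.mul_mem (A'.inv_mem (hsA ((hO_mul ha q).mpr hq))) ha) (hsA hq), ?_⟩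
    rw [← hπN, map_mul, map_mul, map_inv, hsπ ((hO_mul ha q).mpr hq), hsπ hq]
    group
  let c : Γ → Γ ⧸ N → M := fun a q =>
    if h : a ∈ A' ∧ q ∈ O then φ ⟨(s (π a * q))⁻¹ * a * s q, ht h.1 h.2⟩ else 1
  have hc_of_pos : ∀ {a q} (ha : a ∈ A') (hq : q ∈ O),
      c a q = φ ⟨(s (π a * q))⁻¹ * a * s q, ht ha hq⟩ := fun {a q} ha hq => by
    simp only [c, dif_pos (And.intro ha hq)]
  have hc_of_not : ∀ {a q}, q ∉ O → c a q = 1 := fun {a q} hq =>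
    dif_neg (show ¬ (a ∈ A' ∧ q ∈ O) from fun h => hq h.2)
  have hc_cocycle : ∀ {a a' : Γ}, a ∈ A' → a' ∈ A' → ∀ q,
      c (a * a') q = c a (π a' * q) * c a' q := by
    intro a a' ha ha' q
    by_cases hq : q ∈ O
    · have hq' : π a' * q ∈ O := (hO_mul ha' q).mpr hq
      rw [hc_of_pos (A'.mul_mem ha ha') hq, hc_of_pos ha hq', hc_of_pos ha' hq, ← map_mul]
      congr 1
      apply Subtype.ext
      change (s (π (a * a') * q))⁻¹ * (a * a') * s q =
        (s (π a * (π a' * q)))⁻¹ * a * s (π a' * q) * ((s (π a' * q))⁻¹ * a' * s q)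
      rw [map_mul, mul_assoc (π a)]
      group
    · have hq' : π a' * q ∉ O := fun h => hq ((hO_mul ha' q).mp h)
      rw [hc_of_not hq, hc_of_not hq', hc_of_not hq, mul_one]
  have hc_one : ∀ q, c 1 q = 1 := fun q => by
    have h := hc_cocycle A'.one_mem A'.one_mem q
    rw [mul_one, map_one, one_mul] at h
    exact mul_eq_left.mp h.symm
  -- the twisted action of the factor
  let T : Γ → (Γ ⧸ N) × M → (Γ ⧸ N) × M := fun a x => (π a * x.1, x.2 * c a x.1)
  have hT : ∀ a q m₀, T a (q, m₀) = (π a * q, m₀ * c a q) := fun _ _ _ => rfl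
  have hT_mul : ∀ {a a' : Γ}, a ∈ A' → a' ∈ A' → ∀ x, T (a * a') x = T a (T a' x) := by
    rintro a a' ha ha' ⟨q, m₀⟩
    change (π (a * a') * q, m₀ * c (a * a') q) = (π a * (π a' * q), m₀ * c a' q * c a (π a' * q))
    rw [map_mul, mul_assoc (π a) (π a') q, hc_cocycle ha ha', mul_assoc m₀,
      mul_comm (c a (π a' * q)) (c a' q)]
  have hT_one : ∀ x, T 1 x = x := by
    rintro ⟨q, m₀⟩
    rw [hT, map_one, one_mul, hc_one, mul_one]
  let perm : ∀ a : Γ, a ∈ A' → Equiv.Perm ((Γ ⧸ N) × M) := fun a ha =>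
    { toFun := T a
      invFun := T a⁻¹
      left_inv := fun x => by
        rw [← hT_mul (A'.inv_mem ha) ha, inv_mul_cancel, hT_one]
      right_inv := fun x => by
        rw [← hT_mul ha (A'.inv_mem ha), mul_inv_cancel, hT_one] }
  have hperm : ∀ {a} (ha : a ∈ A') x, perm a ha x = T a x := fun _ _ => rfl
  -- the factor `A` acts by the twist, the factor `C` plainly
  have hinlA : ∀ a : A, e (Coprod.inl a) ∈ A' := fun a => by
    rw [hA']; exact ⟨a, rfl⟩
  let ρA : A →* Equiv.Perm ((Γ ⧸ N) × M) :=
    { toFun := fun a => perm (e (Coprod.inl a)) (hinlA a)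
      map_one' := by
        apply Equiv.ext
        intro x
        rw [hperm (hinlA 1), map_one, map_one, hT_one, Equiv.Perm.one_apply]
      map_mul' := fun a a' => by
        apply Equiv.ext
        intro x
        rw [hperm (hinlA (a * a')), map_mul, map_mul, hT_mul (hinlA a) (hinlA a'),
          Equiv.Perm.mul_apply, hperm (hinlA a), hperm (hinlA a')] }
  have hρA : ∀ (a : A) x, ρA a x = T (e (Coprod.inl a)) x := fun _ _ => rfl
  let plain : Γ → Equiv.Perm ((Γ ⧸ N) × M) := fun g =>
    (Equiv.mulLeft (π g)).prodCongr (Equiv.refl M)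
  have hplain : ∀ g q m₀, plain g (q, m₀) = (π g * q, m₀) := fun _ _ _ => rfl
  let ρC : C →* Equiv.Perm ((Γ ⧸ N) × M) :=
    { toFun := fun y => plain (e (Coprod.inr y))
      map_one' := by
        apply Equiv.ext
        rintro ⟨q, m₀⟩
        rw [hplain, map_one, map_one, map_one, one_mul, Equiv.Perm.one_apply]
      map_mul' := fun y y' => by
        apply Equiv.ext
        rintro ⟨q, m₀⟩
        rw [Equiv.Perm.mul_apply, hplain, hplain, hplain, map_mul, map_mul, map_mul, mul_assoc] }
  have hρC : ∀ (y : C) q m₀, ρC y (q, m₀) = (π (e (Coprod.inr y)) * q, m₀) := fun _ _ _ => rfl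
  -- glue along the coproduct
  let ρ : Γ →* Equiv.Perm ((Γ ⧸ N) × M) := (Coprod.lift ρA ρC).comp e.symm.toMonoidHom
  have hρ_inl : ∀ a : A, ρ (e (Coprod.inl a)) = ρA a := fun a => by
    change Coprod.lift ρA ρC (e.symm (e (Coprod.inl a))) = ρA a
    rw [MulEquiv.symm_apply_apply, Coprod.lift_apply_inl]
  have hρ_inr : ∀ y : C, ρ (e (Coprod.inr y)) = ρC y := fun y => by
    change Coprod.lift ρA ρC (e.symm (e (Coprod.inr y))) = ρC y
    rw [MulEquiv.symm_apply_apply, Coprod.lift_apply_inr]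
  -- (1) on the factor, `ρ` is the twisted action
  have hρA' : ∀ (a : Γ) (ha : a ∈ A') (x : (Γ ⧸ N) × M), ρ a x = T a x := by
    intro a ha x
    have ha' : a ∈ (e.toMonoidHom.comp (Coprod.inl : A →* Coprod A C)).range := hA' ▸ ha
    obtain ⟨a₀, rfl⟩ := ha'
    change ρ (e (Coprod.inl a₀)) x = T (e (Coprod.inl a₀)) x
    rw [hρ_inl, hρA]
  -- (2) `ρ` covers left translation; (3) `ρ` commutes with right translation by `M`
  have hρ_fst_snd : ∀ g : Γ, (∀ (q : Γ ⧸ N) (m₀ : M), (ρ g (q, m₀)).1 = π g * q) ∧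
      ∀ (q : Γ ⧸ N) (m₀ m : M), ρ g (q, m₀ * m) = ((ρ g (q, m₀)).1, (ρ g (q, m₀)).2 * m) := by
    intro g
    obtain ⟨w, rfl⟩ := e.surjective g
    refine Coprod.induction_on w ?_ ?_ ?_
    · intro a
      refine ⟨fun q m₀ => ?_, fun q m₀ m => ?_⟩
      · rw [hρ_inl, hρA, hT]
      · rw [hρ_inl, hρA, hρA, hT, hT, mul_right_comm]
    · intro y
      refine ⟨fun q m₀ => ?_, fun q m₀ m => ?_⟩
      · rw [hρ_inr, hρC]
      · rw [hρ_inr, hρC, hρC]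
    · rintro w w' ⟨ih₁, ih₂⟩ ⟨ih₁', ih₂'⟩
      refine ⟨fun q m₀ => ?_, fun q m₀ m => ?_⟩
      · rw [map_mul e, map_mul ρ, Equiv.Perm.mul_apply, map_mul π, mul_assoc, ← ih₁' q m₀]
        exact ih₁ (ρ (e w') (q, m₀)).1 (ρ (e w') (q, m₀)).2
      · rw [map_mul e, map_mul ρ, Equiv.Perm.mul_apply, Equiv.Perm.mul_apply, ih₂']
        exact ih₂ (ρ (e w') (q, m₀)).1 (ρ (e w') (q, m₀)).2 m
  have hρ_fst : ∀ (g : Γ) (q : Γ ⧸ N) (m₀ : M), (ρ g (q, m₀)).1 = π g * q :=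
    fun g => (hρ_fst_snd g).1
  have hρ_snd : ∀ (g : Γ) (q : Γ ⧸ N) (m₀ m : M),
      ρ g (q, m₀ * m) = ((ρ g (q, m₀)).1, (ρ g (q, m₀)).2 * m) := fun g => (hρ_fst_snd g).2
  have hρN : ∀ {n : Γ}, n ∈ N → ∀ (q : Γ ⧸ N) (m₀ : M), ρ n (q, m₀) = (q, (ρ n (q, m₀)).2) := by
    intro n hn q m₀
    exact Prod.ext (by rw [hρ_fst, hπN.mpr hn, one_mul]) rfl
  -- the character `χ(n) = pr₂ (ρ n (1, 1))`
  let χ : N →* M :=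
    { toFun := fun n => (ρ (n : Γ) ((1 : Γ ⧸ N), (1 : M))).2
      map_one' := by
        change (ρ ((1 : N) : Γ) ((1 : Γ ⧸ N), (1 : M))).2 = 1
        rw [OneMemClass.coe_one, map_one, Equiv.Perm.one_apply]
      map_mul' := fun n n' => by
        change (ρ ((n : Γ) * n') ((1 : Γ ⧸ N), (1 : M))).2 =
          (ρ (n : Γ) ((1 : Γ ⧸ N), (1 : M))).2 * (ρ (n' : Γ) ((1 : Γ ⧸ N), (1 : M))).2
        have e' : ρ (n' : Γ) ((1 : Γ ⧸ N), (1 : M)) = (1, (ρ (n' : Γ) ((1 : Γ ⧸ N), (1 : M))).2) :=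
          hρN n'.2 1 1
        have h := hρ_snd (n : Γ) 1 1 (ρ (n' : Γ) ((1 : Γ ⧸ N), (1 : M))).2
        rw [one_mul] at h
        rw [map_mul ρ, Equiv.Perm.mul_apply, e', h] }
  have hχ : ∀ (n : Γ) (hn : n ∈ N), χ ⟨n, hn⟩ = (ρ n ((1 : Γ ⧸ N), (1 : M))).2 := fun _ _ => rfl
  have hχ_conj : ∀ (g x : Γ) (hx : x ∈ A' ⊓ N),
      χ ⟨g * x * g⁻¹, hN.conj_mem x hx.2 g⟩ = c x (π g⁻¹) := by
    intro g x hx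
    rw [hχ, map_mul ρ, map_mul ρ, Equiv.Perm.mul_apply, Equiv.Perm.mul_apply]
    set y := ρ g⁻¹ ((1 : Γ ⧸ N), (1 : M)) with hy
    have hy1 : y.1 = π g⁻¹ := by
      have h := hρ_fst g⁻¹ 1 1
      rw [← hy, mul_one] at h
      exact h
    have hxy : ρ x y = (y.1, y.2 * c x (π g⁻¹)) := by
      rw [hρA' x hx.1]
      change (π x * y.1, y.2 * c x y.1) = (y.1, y.2 * c x (π g⁻¹))
      rw [hπN.mpr hx.2, one_mul, hy1]
    rw [hxy, hρ_snd g y.1 y.2, Prod.mk.eta, hy, ← Equiv.Perm.mul_apply, ← map_mul, mul_inv_cancel,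
      map_one, Equiv.Perm.one_apply]
    exact one_mul _
  refine ⟨χ, fun x hx => ?_, fun g hg x hx => ?_⟩
  · rw [hχ_conj f x hx]
    have hfO : π f⁻¹ ∈ O := by
      rw [hO_iff, ← map_mul, inv_mul_cancel, map_one]
      exact one_mem _
    have hsf : s (π f⁻¹) ∈ A' ⊓ N := by
      refine Subgroup.mem_inf.mpr ⟨hsA hfO, ?_⟩
      rw [← hπN, hsπ hfO, ← map_mul, inv_mul_cancel, map_one]
    rw [hc_of_pos hx.1 hfO]
    have hmem : (s (π f⁻¹))⁻¹ * x * s (π f⁻¹) ∈ A' ⊓ N :=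
      (A' ⊓ N).mul_mem ((A' ⊓ N).mul_mem ((A' ⊓ N).inv_mem hsf) hx) hsf
    have heq : (⟨(s (π x * π f⁻¹))⁻¹ * x * s (π f⁻¹), ht hx.1 hfO⟩ : ↥(A' ⊓ N)) =
        ⟨(s (π f⁻¹))⁻¹ * x * s (π f⁻¹), hmem⟩ := by
      apply Subtype.ext
      change (s (π x * π f⁻¹))⁻¹ * x * s (π f⁻¹) = (s (π f⁻¹))⁻¹ * x * s (π f⁻¹)
      rw [hπN.mpr hx.2, one_mul]
    rw [heq, apply_conj_eq φ hx hsf hmem]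
  · rw [hχ_conj g x hx]
    refine hc_of_not fun hgO => hg ?_
    have h1 : π (g⁻¹ * f) ∈ Abar := by rw [map_mul]; exact hgO
    obtain ⟨a, ha, n, hn, h⟩ := Set.mem_mul.mp (hAN.mp h1)
    rw [← normal_coe_mul_comm A' N]
    refine Set.mem_mul.mpr ⟨n⁻¹, N.inv_mem hn, a⁻¹, A'.inv_mem ha, ?_⟩
    rw [← mul_inv_rev, h, mul_inv_rev, inv_inv]

/-- **Separating normal subgroup for a free factor of a free product** ([CombGC] Prop. 1.2 proof p. 9,
verticial case at one vertex, free-product form): if some character of `A' ∩ N` with values in a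
finite abelian group `M` does not vanish at `x₀`, there is `U ⊴ N` with `N/U ↪ M`, `f x₀ f⁻¹ ∉ U` and
`g (A' ∩ N) g⁻¹ ⊆ U` whenever `f⁻¹ g ∉ A' N`. [cite: SerreTrees1980, I §5.5 Thm. 14] -/
theorem exists_normal_separating_of_freeProduct (e : Coprod A C ≃* Γ)
    (A' : Subgroup Γ) (hA' : A' = (e.toMonoidHom.comp (Coprod.inl : A →* Coprod A C)).range)
    (N : Subgroup Γ) [hN : N.Normal] {M : Type*} [CommGroup M] [Finite M] (φ : ↥(A' ⊓ N) →* M)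
    (x₀ : Γ) (hx₀ : x₀ ∈ A' ⊓ N) (hφ : φ ⟨x₀, hx₀⟩ ≠ 1) (f : Γ) :
    ∃ U : Subgroup N, U.Normal ∧ U.index ∣ Nat.card M ∧ U.FiniteIndex ∧
      f * x₀ * f⁻¹ ∉ U.map N.subtype ∧
      ∀ g : Γ, f⁻¹ * g ∉ (A' : Set Γ) * (N : Set Γ) →
        ConjAct.toConjAct g • (A' ⊓ N) ≤ U.map N.subtype := by
  classical
  obtain ⟨χ, hχf, hχg⟩ := exists_character_extension_of_freeProduct e A' hA' N φ f
  refine ⟨χ.ker, inferInstance, ?_, ?_, ?_, ?_⟩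
  · rw [Subgroup.index_ker]
    exact Subgroup.card_subgroup_dvd_card χ.range
  · refine ⟨fun h0 => ?_⟩
    rw [Subgroup.index_ker] at h0
    exact (Nat.card_pos (α := χ.range)).ne' h0
  · intro hmem
    obtain ⟨u, hu, hu'⟩ := Subgroup.mem_map.mp hmem
    have hu'' : u = ⟨f * x₀ * f⁻¹, hN.conj_mem _ hx₀.2 f⟩ := Subtype.ext hu'
    apply hφ
    rw [← hχf x₀ hx₀, ← hu'']
    exact hu
  · intro g hg z hz
    obtain ⟨x, hxB, rfl⟩ := (Subgroup.mem_smul_pointwise_iff_exists _ _ _).mp hz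
    rw [ConjAct.smul_def, ConjAct.ofConjAct_toConjAct]
    exact Subgroup.mem_map.mpr ⟨⟨g * x * g⁻¹, hN.conj_mem x hxB.2 g⟩, hχg g hg x hxB, rfl⟩

end FreeProductFibredTwist

end Literature.GroupTheory.CombinatorialGroupTheory
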